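import Literature.Geometry.Lorentzian.KerrSchildCoord
import Literature.Geometry.Lorentzian.SchwarzschildKerrSchildComponents
import HarnessLib

/-!
# Stub `stub_regionOneScri` of crux `SwallowTheDatum.UniversalWitnessFamily`
# (stmt-FinalStateConjecture-10051, line `Sketch`), part 1/4: Kerr–Schild algebra of the Schwarzschild
# exterior

Elementary facts about the `a = 0` Kerr–Schild metric `g = η + (2M/r) ℓ ⊗ ℓ`, `ℓ = (1, x⃗/r)`, `r = ‖x⃗‖`
(`Kerr.bilin M 0`), on the exterior `{r > 2M}` (Dafermos–Rodnianski, arXiv:0811.0354, §5.1), used by the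
sojourn estimate of `stub_regionOneScri` (part 4):

* the tortoise radius `r* = r + 2M log(r/2M − 1)`, the retarded time `u = t − r* = t* − r − 4M log(r/2M − 1)`
  and the advanced time `v = t + r* = t* + r` of the static time `t = t* − 2M log(r/2M − 1)` (written out
  explicitly, no definitions), `v − u = 2 r*` (`vKS_sub_uKS`) and the monotonicity of `r*`;
* **the null-cone identity** (`energy_sq_sub_radial_sq`): for a null vector `w` at `x`, `E := −g(w, ∂_{t*})`
  and `ṙ := ⟨x⃗, w⃗⟩/r` satisfy `E² − ṙ² = (1 − 2M/r)(|w⃗|² − ṙ²)`, whence `ṙ² ≤ E²` on the exterior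
  (`radial_sq_le_energy_sq`; Wald 1984, (6.3.12)–(6.3.15), without separating the angular momentum),
  the signs of the rates `u̇ = (E − ṙ)/(1 − 2M/r)`, `v̇ = (E + ṙ)/(1 − 2M/r)` (`uRate_nonneg`,
  `vRate_nonneg`), and a bound on `‖w‖` away from `r = 2M` (`norm_sq_le_of_null`).

References: M. Dafermos, I. Rodnianski, *Lectures on black holes and linear waves*, arXiv:0811.0354,
§2.6.2, §5.1; R. M. Wald, *General Relativity* (1984), §6.3, (6.3.12)–(6.3.15), (6.4.20).
-/

set_option linter.dupNamespace false

noncomputable section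

namespace Summit.FinalStateConjecture.FinalStateConjecture.Theorems.SwallowTheDatum.UniversalWitnessFamily

open scoped Manifold ContDiff Topology RealInnerProductSpace
open Set Function Filter Bundle Metric Literature.Geometry.Lorentzian

/-! ## Tortoise radius `r* = r + 2M log(r/2M − 1)`, retarded time `u = t* − r − 4M log(r/2M − 1)`,
## advanced time `v = t* + r` -/

/-- `v − u = 2 r*`. [folklore] -/
theorem vKS_sub_uKS (M : ℝ) (x : E4) :
    (x 0 + E4.spatialNorm x) -
        (x 0 - E4.spatialNorm x - 4 * M * Real.log (E4.spatialNorm x / (2 * M) - 1)) =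
      2 * (E4.spatialNorm x + 2 * M * Real.log (E4.spatialNorm x / (2 * M) - 1)) := by
  ring

/-- The tortoise radius is strictly increasing on `(2M, ∞)` (`M > 0`). [folklore] -/
theorem rstar_lt_rstar {M r₁ r₂ : ℝ} (hM : 0 < M) (h₁ : 2 * M < r₁) (h₁₂ : r₁ < r₂) :
    (r₁ + 2 * M * Real.log (r₁ / (2 * M) - 1)) < (r₂ + 2 * M * Real.log (r₂ / (2 * M) - 1)) := by
  have h2M : 0 < 2 * M := by positivity
  have ha : 0 < r₁ / (2 * M) - 1 := by
    rw [sub_pos, lt_div_iff₀ h2M]; linarith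
  have hab : r₁ / (2 * M) - 1 < r₂ / (2 * M) - 1 := by
    have := div_lt_div_of_pos_right h₁₂ h2M
    linarith
  have hlog := Real.log_lt_log ha hab
  nlinarith

/-- Monotonicity of the tortoise radius on `(2M, ∞)`. [folklore] -/
theorem rstar_le_rstar {M r₁ r₂ : ℝ} (hM : 0 < M) (h₁ : 2 * M < r₁) (h₁₂ : r₁ ≤ r₂) :
    (r₁ + 2 * M * Real.log (r₁ / (2 * M) - 1)) ≤ (r₂ + 2 * M * Real.log (r₂ / (2 * M) - 1)) := by
  rcases h₁₂.eq_or_lt with h | h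
  · rw [h]
  · exact (rstar_lt_rstar hM h₁ h).le

/-- `r ≤ r*` for `r ≥ 4M` (`log(r/2M − 1) ≥ 0`). [folklore] -/
theorem le_rstar {M r : ℝ} (hM : 0 < M) (hr : 4 * M ≤ r) :
    r ≤ r + 2 * M * Real.log (r / (2 * M) - 1) := by
  have h2M : 0 < 2 * M := by positivity
  have h1 : 1 ≤ r / (2 * M) - 1 := by
    rw [le_sub_iff_add_le, le_div_iff₀ h2M]; linarith
  have hlog : 0 ≤ Real.log (r / (2 * M) - 1) := Real.log_nonneg h1
  nlinarith

/-- Points of the exterior with `r* < r*(r')` have `r < r'`. [folklore] -/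
theorem lt_of_rstar_lt {M r r' : ℝ} (hM : 0 < M) (hr' : 2 * M < r')
    (h : r + 2 * M * Real.log (r / (2 * M) - 1) < r' + 2 * M * Real.log (r' / (2 * M) - 1)) :
    r < r' := by
  by_contra hle
  exact absurd (rstar_le_rstar hM hr' (not_lt.1 hle)) (not_le.2 h)

/-! ## The null cone of the Schwarzschild exterior in Kerr–Schild coordinates -/

/-- `g(w, ∂_{t*}) = −w⁰ + (2M/r)(w⁰ + ⟨x⃗, w⃗⟩/r)` for `a = 0`, `r = ‖x⃗‖ ≠ 0`. [folklore] -/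
theorem bilin_basisVector_zero_right (M : ℝ) {x : E4} (hx : E4.spatialNorm x ≠ 0) (w : E4) :
    Kerr.bilin M 0 x w (E4.basisVector 0) =
      -(w 0) + 2 * M / E4.spatialNorm x * (w 0 + ⟪E4.spatial x, E4.spatial w⟫ / E4.spatialNorm x) := by
  have h0 : E4.spatial (E4.basisVector 0) = 0 := by
    ext i
    simp [E4.spatial_apply, Fin.succ_ne_zero]
  rw [Kerr.bilin_zero_spin_apply M hx, h0]
  simp

/-- **The null-cone identity.** For a null vector `w` at a point with `r = ‖x⃗‖ ≠ 0`, with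
`E := −g(w, ∂_{t*})`, `ṙ := ⟨x⃗, w⃗⟩/r`: `E² − ṙ² = (1 − 2M/r)(|w⃗|² − ṙ²)`. Wald 1984, (6.3.12)–(6.3.15)
(radial equation of null geodesics, here without separating the angular momentum). -/
theorem energy_sq_sub_radial_sq (M : ℝ) {x : E4} (hx : E4.spatialNorm x ≠ 0) {w : E4}
    (hw : Kerr.bilin M 0 x w w = 0) :
    Kerr.bilin M 0 x w (E4.basisVector 0) ^ 2 - (⟪E4.spatial x, E4.spatial w⟫ / E4.spatialNorm x) ^ 2 =
      (1 - 2 * M / E4.spatialNorm x) *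
        (‖E4.spatial w‖ ^ 2 - (⟪E4.spatial x, E4.spatial w⟫ / E4.spatialNorm x) ^ 2) := by
  rw [Kerr.bilin_zero_spin_apply M hx, real_inner_self_eq_norm_sq] at hw
  rw [bilin_basisVector_zero_right M hx]
  set k := 2 * M / E4.spatialNorm x
  set ρ' := ⟪E4.spatial x, E4.spatial w⟫ / E4.spatialNorm x
  linear_combination (-(1 - k)) * hw

/-- **`ṙ² ≤ E²` along null vectors of the exterior** (`r > 2M ≥ 0`): the right-hand side of the
null-cone identity is nonnegative by Cauchy–Schwarz. Dafermos–Rodnianski arXiv:0811.0354, §2.6.2. -/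
theorem radial_sq_le_energy_sq {M : ℝ} (hM : 0 ≤ M) {x : E4} (hx : 2 * M < E4.spatialNorm x) {w : E4}
    (hw : Kerr.bilin M 0 x w w = 0) :
    (⟪E4.spatial x, E4.spatial w⟫ / E4.spatialNorm x) ^ 2 ≤ Kerr.bilin M 0 x w (E4.basisVector 0) ^ 2 := by
  have hr : 0 < E4.spatialNorm x := by linarith
  have key := energy_sq_sub_radial_sq M hr.ne' hw
  have hf : 0 < 1 - 2 * M / E4.spatialNorm x := by
    rw [sub_pos, div_lt_one hr]; exact hx
  have hCS : (⟪E4.spatial x, E4.spatial w⟫ / E4.spatialNorm x) ^ 2 ≤ ‖E4.spatial w‖ ^ 2 := by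
    rw [div_pow, div_le_iff₀ (by positivity)]
    have h := abs_real_inner_le_norm (E4.spatial x) (E4.spatial w)
    have h2 : ⟪E4.spatial x, E4.spatial w⟫ ^ 2 ≤ (‖E4.spatial x‖ * ‖E4.spatial w‖) ^ 2 := by
      rw [← sq_abs]; exact pow_le_pow_left₀ (abs_nonneg _) h 2
    simpa [E4.spatialNorm, mul_pow, mul_comm] using h2
  nlinarith [mul_nonneg hf.le (sub_nonneg.2 hCS)]

/-- `|ṙ| ≤ E` for a null vector with `E = −g(w, ∂_{t*}) ≥ 0`. [folklore] -/
theorem abs_radial_le_energy {M : ℝ} (hM : 0 ≤ M) {x : E4} (hx : 2 * M < E4.spatialNorm x) {w : E4}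
    (hw : Kerr.bilin M 0 x w w = 0) {E : ℝ} (hE : 0 ≤ E)
    (hEw : Kerr.bilin M 0 x w (E4.basisVector 0) = -E) :
    |⟪E4.spatial x, E4.spatial w⟫ / E4.spatialNorm x| ≤ E := by
  have h := radial_sq_le_energy_sq hM hx hw
  rw [hEw, neg_sq] at h
  exact abs_le_of_sq_le_sq h hE

/-- **The retarded-time rate is nonnegative**: `u̇ = w⁰ − ṙ (r + 2M)/(r − 2M) = (E − ṙ)/(1 − 2M/r) ≥ 0`
for a null `w` with `E = −g(w, ∂_{t*}) ≥ 0`. Dafermos–Rodnianski arXiv:0811.0354, §2.6.2. -/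
theorem uRate_nonneg {M : ℝ} (hM : 0 ≤ M) {x : E4} (hx : 2 * M < E4.spatialNorm x) {w : E4}
    (hw : Kerr.bilin M 0 x w w = 0) {E : ℝ} (hE : 0 ≤ E)
    (hEw : Kerr.bilin M 0 x w (E4.basisVector 0) = -E) :
    0 ≤ w 0 - ⟪E4.spatial x, E4.spatial w⟫ / E4.spatialNorm x *
      (E4.spatialNorm x + 2 * M) / (E4.spatialNorm x - 2 * M) := by
  have hr : 0 < E4.spatialNorm x := by linarith
  have habs := abs_le.1 (abs_radial_le_energy hM hx hw hE hEw)
  rw [bilin_basisVector_zero_right M hr.ne'] at hEw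
  set r := E4.spatialNorm x with hr_def
  set ρ' := ⟪E4.spatial x, E4.spatial w⟫ / r
  have hsub : 0 < r - 2 * M := by linarith
  -- `w⁰ − ρ'(r+2M)/(r−2M) = (E − ρ') r/(r − 2M)`
  have hid : w 0 - ρ' * (r + 2 * M) / (r - 2 * M) = (E - ρ') * r / (r - 2 * M) := by
    field_simp
    field_simp at hEw
    linear_combination (-1 : ℝ) * hEw
  rw [hid]
  exact div_nonneg (mul_nonneg (by linarith) hr.le) hsub.le

/-- **The advanced-time rate is nonnegative**: `v̇ = w⁰ + ṙ = (E + ṙ)/(1 − 2M/r) ≥ 0` for a null `w`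
with `E = −g(w, ∂_{t*}) ≥ 0`. Dafermos–Rodnianski arXiv:0811.0354, §2.6.2. -/
theorem vRate_nonneg {M : ℝ} (hM : 0 ≤ M) {x : E4} (hx : 2 * M < E4.spatialNorm x) {w : E4}
    (hw : Kerr.bilin M 0 x w w = 0) {E : ℝ} (hE : 0 ≤ E)
    (hEw : Kerr.bilin M 0 x w (E4.basisVector 0) = -E) :
    0 ≤ w 0 + ⟪E4.spatial x, E4.spatial w⟫ / E4.spatialNorm x := by
  have hr : 0 < E4.spatialNorm x := by linarith
  have habs := abs_le.1 (abs_radial_le_energy hM hx hw hE hEw)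
  rw [bilin_basisVector_zero_right M hr.ne'] at hEw
  set r := E4.spatialNorm x with hr_def
  set ρ' := ⟪E4.spatial x, E4.spatial w⟫ / r
  have hsub : 0 < r - 2 * M := by linarith
  have hid : w 0 + ρ' = (E + ρ') * r / (r - 2 * M) := by
    field_simp
    field_simp at hEw
    linear_combination (-1 : ℝ) * hEw
  rw [hid]
  exact div_nonneg (mul_nonneg (by linarith) hr.le) hsub.le

/-- **Null vectors are bounded away from the horizon**: if `1 − 2M/r ≥ f₀ > 0` at `x` then every null
`w` satisfies `‖w‖² ≤ ((2/f₀ + 1)² + (1/f₀ + 1)) E²`, `E = −g(w, ∂_{t*})`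
(`v̇ = (E + ṙ)/f`, `w⁰ = v̇ − ṙ`, `|w⃗|² = ṙ² + (E² − ṙ²)/f`). [folklore] -/
theorem norm_sq_le_of_null {M : ℝ} (hM : 0 ≤ M) {x : E4} {f₀ : ℝ} (hf₀ : 0 < f₀)
    (hxf : f₀ ≤ 1 - 2 * M / E4.spatialNorm x) (hx : 2 * M < E4.spatialNorm x) {w : E4}
    (hw : Kerr.bilin M 0 x w w = 0) :
    ‖w‖ ^ 2 ≤ ((2 / f₀ + 1) ^ 2 + (1 / f₀ + 1)) * Kerr.bilin M 0 x w (E4.basisVector 0) ^ 2 := by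
  have hr : 0 < E4.spatialNorm x := by linarith
  have hsq := radial_sq_le_energy_sq hM hx hw
  have key := energy_sq_sub_radial_sq M hr.ne' hw
  have hEw := bilin_basisVector_zero_right M hr.ne' w
  have hsplit : ‖w‖ ^ 2 = w 0 ^ 2 + ‖E4.spatial w‖ ^ 2 := by
    rw [← real_inner_self_eq_norm_sq, ← real_inner_self_eq_norm_sq, Kerr.inner_eq_time_add_spatial]
    ring
  rw [hsplit]
  set r := E4.spatialNorm x with hr_def
  set ρ' := ⟪E4.spatial x, E4.spatial w⟫ / r
  set p := Kerr.bilin M 0 x w (E4.basisVector 0)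
  set f := 1 - 2 * M / r with hf_def
  set n := ‖E4.spatial w‖
  have hf1 : f ≤ 1 := by
    have : 0 ≤ 2 * M / r := by positivity
    linarith
  have hfpos : 0 < f := lt_of_lt_of_le hf₀ hxf
  have hk : 2 * M / r = 1 - f := by rw [hf_def]; ring
  rw [hk] at hEw
  -- `|ρ'| ≤ |p|`, `f w⁰ = -p + (1 - f) ρ'`, `f n² = p² - ρ'² + f ρ'²`
  have hw0 : f * w 0 = -p + (1 - f) * ρ' := by rw [hEw]; ring
  have hn : f * n ^ 2 = p ^ 2 - ρ' ^ 2 + f * ρ' ^ 2 := by linarith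
  have habs : |ρ'| ≤ |p| := sq_le_sq.1 hsq
  -- the time component: `(f w⁰)² ≤ 4 p²`, so `w⁰² ≤ (2/f₀)² p²`
  have h1 : (f * w 0) ^ 2 ≤ (2 * |p|) ^ 2 := by
    rw [hw0]
    refine sq_le_sq' ?_ ?_ <;>
      nlinarith [abs_nonneg p, neg_abs_le p, le_abs_self p, neg_abs_le ρ', le_abs_self ρ',
        abs_nonneg ρ']
  have h1' : f₀ ^ 2 * w 0 ^ 2 ≤ 4 * p ^ 2 :=
    calc f₀ ^ 2 * w 0 ^ 2 ≤ f ^ 2 * w 0 ^ 2 := by gcongr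
      _ = (f * w 0) ^ 2 := by ring
      _ ≤ (2 * |p|) ^ 2 := h1
      _ = 4 * p ^ 2 := by rw [mul_pow, sq_abs]; norm_num
  have hw0' : w 0 ^ 2 ≤ (2 / f₀) ^ 2 * p ^ 2 := by
    rw [div_pow, div_mul_eq_mul_div, le_div_iff₀ (by positivity)]
    linarith
  -- the spatial part: `n² ≤ (1/f₀ + 1) p²`
  have hn' : n ^ 2 ≤ (1 / f₀ + 1) * p ^ 2 := by
    have hff : 1 ≤ f / f₀ := (one_le_div hf₀).2 hxf
    have hp2 : 0 ≤ p ^ 2 := sq_nonneg _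
    have hρ2 : ρ' ^ 2 ≤ p ^ 2 := hsq
    have h3 : f * n ^ 2 ≤ f * ((1 / f₀ + 1) * p ^ 2) := by
      have e : f * ((1 / f₀ + 1) * p ^ 2) = f / f₀ * p ^ 2 + f * p ^ 2 := by ring
      rw [hn, e]
      nlinarith [mul_le_mul_of_nonneg_right hff hp2, mul_le_mul_of_nonneg_left hρ2 hfpos.le]
    exact le_of_mul_le_mul_left h3 hfpos
  have hp2 : 0 ≤ p ^ 2 := sq_nonneg _
  have hA : (2 / f₀) ^ 2 ≤ (2 / f₀ + 1) ^ 2 := by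
    have : 0 ≤ 2 / f₀ := by positivity
    nlinarith
  nlinarith [mul_le_mul_of_nonneg_right hA hp2]

/-- **Anchor of part 1** (registered sub-goal `regionOneScri_nullCone` of stub `stub_regionOneScri`):
the null-cone inequality `ṙ² ≤ E²` on the Schwarzschild exterior (`radial_sq_le_energy_sq`).
Dafermos–Rodnianski arXiv:0811.0354, §2.6.2. -/
theorem regionOneScri_nullCone :
    ∀ (M : ℝ) (x w : E4), 0 ≤ M → 2 * M < E4.spatialNorm x → Kerr.bilin M 0 x w w = 0 → (inner ℝ
      (E4.spatial x) (E4.spatial w) / E4.spatialNorm x) ^ 2 ≤ Kerr.bilin M 0 x w (E4.basisVector 0)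
      ^ 2 :=
  fun _ _ _ hM hx hw ↦ radial_sq_le_energy_sq hM hx hw

end Summit.FinalStateConjecture.FinalStateConjecture.Theorems.SwallowTheDatum.UniversalWitnessFamily

end
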